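import Mathlib
import Summits.ValiantsHypothesis.ValiantsHypothesis.Theorems.RefutationDegreeDefs
import Summits.ValiantsHypothesis.ValiantsHypothesis.Theorems.RefutationDegreeBeyondHessianNsKernelPlane

/-!
# Crux `RefutationBarrier` (stmt-ValiantsHypothesis-5642), line `Sketch_ideator4` — stub `stub_exists_kernelFlat`

**Exact kernel flat of an affine pencil (L1d).**  Let `A := (pencil n m).map (map (eval a))` be the
generic size-`m` affine pencil `A(x) = A₀ + Σ_e x_e A_e` evaluated at a complex point `a` of the
unknowns: an `m × m` matrix of AFFINE polynomials in the `n²` variables `x_e`, with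
`map (eval a) (det (pencil n m)) = det A`.  At a zero `z` of `det A(x)` the matrix `A(z)` is
singular; pick `u ≠ 0` with `A(z) u = 0`.  Writing `A(x) u = A(0) u + Φ x` with the linear map
`Φ x = Σ_w x_w (A_w u)` (`map_eval_mulVec_eq` of the kernel-plane file), every `v ∈ K := ker Φ`
gives `A(z + v) u = A(z) u + Φ v = 0`, so `det A(z + v) = 0`; and `dim K = n² - rank Φ ≥ n² - m`.

This is the first half of `exists_submodule_of_isAffineDetRepr`
(`Theorems/RefutationDegreeBeyondHessianNsKernelPlane.lean`) without homogeneity: the flat is the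
affine one `z + ker Φ`, no line through the origin is added.  All folklore.
-/

-- `Summit.ValiantsHypothesis.ValiantsHypothesis.…` is the tree's mandated single-conjunct layout
-- (Sub = Summit), so the duplicated namespace component is intended.
set_option linter.dupNamespace false

noncomputable section

namespace Summit.ValiantsHypothesis.ValiantsHypothesis.Theorems.RefutationDegree

open MvPolynomial Matrix
open Literature.Computability.AlgebraicComplexity
open Summit.ValiantsHypothesis.ValiantsHypothesis.Theorems.RefutationDegreeBeyondHessianNs

/-- The entries of the generic pencil evaluated at a point `a` of the unknowns,
`a (none,(i,j)) + Σ_e x_e · a (some e,(i,j))`, are affine in `x`: total degree `≤ 1`. [folklore] -/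
private theorem totalDegree_pencil_map_le {n m : ℕ} (a : Unk n m → ℂ) (i j : Fin m) :
    (((pencil n m).map (MvPolynomial.map (eval a))) i j).totalDegree ≤ 1 := by
  simp only [Matrix.map_apply, pencil, Matrix.of_apply, map_add, map_sum, map_mul, map_X, map_C]
  refine (totalDegree_add _ _).trans (max_le ?_ ?_)
  · rw [totalDegree_C]
    exact Nat.zero_le _
  · refine totalDegree_finsetSum_le fun e _ => (totalDegree_mul _ _).trans ?_
    rw [totalDegree_C, add_zero, totalDegree_X]

/-- **Stub (L1d) — exact kernel flat of an affine pencil.**  At a zero `z` of `det A(x)`, `A` the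
generic size-`m` pencil evaluated at a complex point `a` of the unknowns, the flat `z + ker Φ`
(`Φ x = Σ_w x_w (A_w u)`, `u ≠ 0` a null vector of `A(z)`) has dimension `≥ n² − m` and lies in
`{det A = 0}`. [folklore] -/
theorem stub_exists_kernelFlat {n m : ℕ} (a : Unk n m → ℂ) (z : Fin n × Fin n → ℂ)
    (hz : eval z (MvPolynomial.map (eval a) (pencil n m).det) = 0) :
    ∃ K : Submodule ℂ (Fin n × Fin n → ℂ), n ^ 2 ≤ Module.finrank ℂ K + m ∧
      ∀ v ∈ K, eval (z + v) (MvPolynomial.map (eval a) (pencil n m).det) = 0 := by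
  classical
  set A : Matrix (Fin m) (Fin m) (MvPolynomial (Fin n × Fin n) ℂ) :=
    (pencil n m).map (MvPolynomial.map (eval a)) with hAdef
  have hA : ∀ i j, (A i j).totalDegree ≤ 1 := totalDegree_pencil_map_le a
  -- `map (eval a) (det pencil) = det A`, and evaluation commutes with `det`
  have hdet : MvPolynomial.map (eval a) (pencil n m).det = A.det := by
    rw [RingHom.map_det, RingHom.mapMatrix_apply]
  have heval : ∀ x : Fin n × Fin n → ℂ,
      eval x (MvPolynomial.map (eval a) (pencil n m).det) = (A.map (eval x)).det := fun x => by
    rw [hdet, RingHom.map_det, RingHom.mapMatrix_apply]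
  -- `A(z)` is singular: pick a kernel vector `u ≠ 0`
  have hsing : (A.map (eval z)).det = 0 := by rw [← heval, hz]
  obtain ⟨u, hu0, hu⟩ := Matrix.exists_mulVec_eq_zero_iff.mpr hsing
  set Φ : (Fin n × Fin n → ℂ) →ₗ[ℂ] (Fin m → ℂ) :=
    Matrix.mulVecLin (Matrix.of fun i w => (LRPencil.coeffMat A w *ᵥ u) i) with hΦ
  have hΦapply : ∀ x, Φ x = (Matrix.of fun i w => (LRPencil.coeffMat A w *ᵥ u) i) *ᵥ x :=
    fun x => rfl
  refine ⟨LinearMap.ker Φ, ?_, ?_⟩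
  · -- dimension count: `n² = rank Φ + null Φ ≤ m + dim K`
    have h1 := LinearMap.finrank_range_add_finrank_ker Φ
    have h2 : Module.finrank ℂ (LinearMap.range Φ) ≤ m := by
      calc Module.finrank ℂ (LinearMap.range Φ) ≤ Module.finrank ℂ (Fin m → ℂ) :=
            Submodule.finrank_le _
        _ = m := by simp
    have h4 : Module.finrank ℂ (Fin n × Fin n → ℂ) = n ^ 2 := by
      rw [Module.finrank_fintype_fun_eq_card, Fintype.card_prod, Fintype.card_fin, sq]
    rw [h4] at h1
    omega
  · -- zeros: `A(z + v) u = A(z) u + Φ v = 0`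
    intro v hv
    rw [LinearMap.mem_ker] at hv
    have h1 : A.map (eval (z + v)) *ᵥ u = 0 := by
      rw [map_eval_mulVec_eq A hA u (z + v), ← hΦapply, map_add, hv, add_zero, hΦapply,
        ← map_eval_mulVec_eq A hA u z, hu]
    rw [heval]
    exact Matrix.exists_mulVec_eq_zero_iff.mp ⟨u, hu0, h1⟩

end Summit.ValiantsHypothesis.ValiantsHypothesis.Theorems.RefutationDegree

end
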